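import Literature.AlgebraicGeometry.Motives.WeilHermitianSplitting
import Literature.AlgebraicGeometry.Motives.WeilHermitianWitt
import Literature.AlgebraicGeometry.Motives.WeilDiscriminantSplit
import Literature.AlgebraicGeometry.Motives.WeilDiscriminantProduct
import HarnessLib

/-!
# Ring 2 · Hypotheses layer (typer2, gen 20, part XXX-A) — the abstract LANDHERR STEP for `K = ℚ(α)`, `α² = -d`:
  a presplit `K`-Hermitian form of rank `2n` and discriminant `[(-1)ⁿ]` is hyperbolic; coordinates `Kᴺ ≃_ℚ ℚ^{N ⊔ N}`

research route conditional on HC_CM; not a corollary; Q11.4-sentence-2 already refuted in dim ≥ 3.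

HONEST FRAMING. Pure linear algebra, no geometry and no case of the Hodge conjecture: this part supplies the two
algebraic inputs of part XXX-B (`Ring2HypothesesLandherrConverse`, which discharges the obligation nodes
`LandherrHyperbolicOfSplitDiscriminant` / `LandherrSplitCriterion` of the hypotheses census).

§1 `exists_isotropic_of_presplit_of_discr` (van Geemen 5.4 (5.4.1) after Landherr 1936, for `K = ℚ(√-d)`; Deligne–
Milne §4 Cor. 4.2). Data: a field `K ⊇ ℚ` spanned by `1, α`, `α² = -d < 0`, `σ α = -α`, `k σ(k) = Nm k`; a `K`-space
`V` of dimension `2n ≥ 2` with an alternating `ℚ`-bilinear `E`, `E(αx, αy) = d E(x, y)`, non-degenerate, and its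
Hermitian form `H = weilHermitianForm E α`; a PRESPLITTING — an `H`-isotropic `L` of dimension `n - 1` and `p, q ⊥ L`,
`p ⊥ q`, `Q(p) > 0 > Q(q)` (`Q(x) = E(x, αx)`; the tree's `exists_weil_presplitting` produces it from signature
`(n, n)` by Meyer's theorem) — and `disc H = [(-1)ⁿ]` in `ℚ^×/Nm(K^×)`. Conclusion: a totally `H`-isotropic
`K`-subspace `W` of dimension `n`. Proof: a hyperbolic partner family `f` of a basis `e` of `L` (the tree's
`exists_hyperbolicFamily_of_isotropic`), the `H`-projections `p̃, q̃` of `p, q` off `span(e, f)`, the block Gram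
determinant `det = (-1)^{n-1} Q(p) Q(q)` (the tree's `det_gramMatrix_eq_of_isotropic`), hence — comparing with
`[(-1)ⁿ]` through `discrClass_eq_of_basis` — `-Q(p)Q(q) = Nm(λ)`, and `t = λp + Q(p)q` is isotropic, `⊥ L`, `∉ L`:
`W = L ⊕ Kt`.

§2 `exists_frameCoord`: the `ℚ`-linear real/imaginary coordinates `Kᴺ ≃ ℚ^{N ⊔ N}` (`k = re k + im k · α`) with the
matrix of `α` (`(re, im) ↦ (-d im, re)`) and the coordinates of `eᵢ`, `α eᵢ`.

Placement: `Summits/` (derived helper of our own discharge; the published statements used are cited Literature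
files, by name). Standard axioms only; no `sorry`. [cite: vanGeemen1994HodgeAV, Lemma 5.2 (2)–(3) and 5.4 (5.4.1)]
[cite: Deligne1982HodgeCycles, §4 Cor. 4.2] [cite: Landherr1936HermitianForms]
-/

noncomputable section

set_option linter.dupNamespace false

open Polynomial Module
open scoped Matrix
open Literature.AlgebraicGeometry Literature.AlgebraicGeometry.Motives

namespace Summit.HodgeConjecture.HodgeConjecture.Ring2.Hypotheses


/-! ## §1 The algebraic step: an `(n-1)`-presplit Hermitian space of `K`-rank `2n` with discriminant `(-1)ⁿ`
is split (Landherr's converse for `K = ℚ(√-d)`, given Meyer's presplitting) -/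

section LandherrStep

variable {K : Type*} [Field K] [Algebra ℚ K] {V : Type*} [AddCommGroup V] [Module ℚ V] [Module K V]
  [IsScalarTower ℚ K V]

omit [Algebra ℚ K] [Module ℚ V] [IsScalarTower ℚ K V] in
/-- A family whose Gram matrix (for a form `K`-linear in the second variable) has non-zero determinant is
linearly independent: pairing a relation `Σ gₖ cₖ = 0` with each `cⱼ` gives `Ψ g = 0`. [folklore] -/
theorem linearIndependent_of_det_gramMatrix_ne_zero {ι : Type*} [Fintype ι] [DecidableEq ι] {σ : K →+* K}
    (B : V →ₛₗ[σ] V →ₗ[K] K) (c : ι → V) (hdet : (gramMatrix (fun x y => B x y) c).det ≠ 0) :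
    LinearIndependent K c := by
  rw [Fintype.linearIndependent_iff]
  intro g hg
  have h : (gramMatrix (fun x y => B x y) c) *ᵥ g = 0 := by
    funext j
    have hj := congrArg (B (c j)) hg
    rw [map_sum, map_zero] at hj
    simp only [map_smul, smul_eq_mul] at hj
    rw [Pi.zero_apply, ← hj, Matrix.mulVec, dotProduct]
    exact Finset.sum_congr rfl fun k _ => by rw [gramMatrix_apply, mul_comm]
  exact fun i => congrFun (Matrix.eq_zero_of_mulVec_eq_zero hdet h) i

/-- **Landherr's converse for `K = ℚ(√-d)`, from a Meyer presplitting** (van Geemen 1994, 5.4 (5.4.1) "`H` is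
hyperbolic iff `det H = (-1)ⁿ ∈ ℚ^×/Nm(K^×)`", direction ⇐, in the generality of the tree's Hermitian-form files:
`α² = -d < 0`, `K = ℚ + ℚα`, `σ α = -α`, `k σ(k) = Nm k`). Let `E` be an alternating `ℚ`-bilinear form of Weil
type on a `K`-space `V` of dimension `2n ≥ 2`, left-separating, `H = weilHermitianForm E α`; let `L` be an
`H`-isotropic `K`-subspace of dimension `n - 1` and `p, q ⊥ L`, `H(p, q) = 0`, `Q(p) = E(p, αp) > 0 > Q(q)` (the
output of `Motives.exists_weil_presplitting`). If the discriminant of `H` is `(-1)ⁿ` modulo norms, then `V`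
contains an `H`-isotropic `K`-subspace of dimension `n`. Proof: a hyperbolic partner family `f` of a basis `e` of
`L` (Deligne–Milne 4.2), `p̃ = p - Σ H(fᵢ, p) eᵢ`, `q̃` likewise; in the basis `(e, f, p̃, q̃)` the Gram matrix is
block-triangular with determinant `(-1)^{n-1} · 1 · Q(p) Q(q)`; comparing with `(-1)ⁿ` gives `λ ∈ K^×` with
`Nm λ = -Q(p)Q(q)`; `t = λ p + Q(p) q` is isotropic, `⊥ L`, and `H(q, t) = Q(p)Q(q) ≠ 0` so `t ∉ L`;
`W = L + K t`. [cite: vanGeemen1994HodgeAV, Lemma 5.2 (2)–(3) and 5.4 (5.4.1) (PDF p. 220)]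
[cite: Deligne1982HodgeCycles, §4 Cor. 4.2 (proof)] [cite: Landherr1936HermitianForms, main theorem (case `ℚ(√-d)`)] -/
theorem exists_isotropic_of_presplit_of_discr {σ : K →+* K} {α : K} {d : ℚ} (E : LinearMap.BilinForm ℚ V)
    (hd : 0 < d) (hα : α * α = algebraMap ℚ K (-d))
    (hK : ∀ k : K, ∃ a b : ℚ, k = algebraMap ℚ K a + algebraMap ℚ K b * α)
    (hσα : σ α = -α) (hσ : ∀ k : K, k * σ k = algebraMap ℚ K (Algebra.norm ℚ k))
    (hE : ∀ x y : V, E x y = -E y x) (hW : ∀ x y : V, E (α • x) (α • y) = d * E x y)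
    [Module.Finite K V] {n : ℕ} (hn : 1 ≤ n) (hV : finrank K V = 2 * n)
    (hsep : ∀ x : V, (∀ z, E x z = 0) → x = 0)
    {L : Submodule K V} {p q : V} (hL : finrank K L = n - 1)
    (hLL : ∀ x ∈ L, ∀ y ∈ L, weilHermitianForm E α x y = 0)
    (hpL : ∀ x ∈ L, weilHermitianForm E α p x = 0) (hqL : ∀ x ∈ L, weilHermitianForm E α q x = 0)
    (hpq : weilHermitianForm E α p q = 0) (hp : 0 < E p (α • p)) (hq : E q (α • q) < 0)
    (hdisc : weilDiscriminant E α = (QuotientGroup.mk ((-1 : ℚˣ) ^ n) : ℚˣ ⧸ normUnitsSubgroup ℚ K)) :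
    ∃ W : Submodule K V, finrank K W = n ∧ ∀ x ∈ W, ∀ y ∈ W, weilHermitianForm E α x y = 0 := by
  classical
  obtain ⟨m, rfl⟩ : ∃ m, n = m + 1 := ⟨n - 1, by omega⟩
  rw [Nat.add_sub_cancel] at hL
  -- the bundled `σ`-sesquilinear form `B = H`
  set B := weilSesqForm E σ hd.ne' hα hW hσα hK with hBdef
  have hBH : ∀ x y, B x y = weilHermitianForm E α x y := fun x y => rfl
  have hE' : ∀ x y : V, E y x = -E x y := fun x y => hE y x
  have hB : ∀ x y, σ (B x y) = B y x := fun x y =>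
    map_weilHermitianForm_eq_swap E σ hd.ne' hα hE' hW hσα x y
  have hσq : ∀ r : ℚ, σ (algebraMap ℚ K r) = algebraMap ℚ K r := fun r => by
    rw [eq_ratCast, map_ratCast]
  have h2 : (2 : K) ≠ 0 := by
    rw [show (2 : K) = algebraMap ℚ K 2 by rw [map_ofNat]]
    exact (_root_.map_ne_zero _).2 two_ne_zero
  have hExx : ∀ x : V, E x x = 0 := fun x => by have h := hE x x; linarith
  have hBself : ∀ x, B x x = algebraMap ℚ K (E x (α • x)) := fun x => by
    rw [hBH, weilHermitianForm_apply, hExx, map_zero, mul_zero, add_zero]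
  have hLL' : ∀ x ∈ L, ∀ y ∈ L, B x y = 0 := fun x hx y hy => by rw [hBH]; exact hLL x hx y hy
  have hpL' : ∀ x ∈ L, B p x = 0 := fun x hx => by rw [hBH]; exact hpL x hx
  have hqL' : ∀ x ∈ L, B q x = 0 := fun x hx => by rw [hBH]; exact hqL x hx
  have hpq' : B p q = 0 := by rw [hBH]; exact hpq
  -- `B` is right-separating (from `E` left-separating and alternating)
  have hN : ∀ y, (∀ x, B x y = 0) → y = 0 := fun y hy => hsep y fun z => by
    have h := apply_eq_zero_of_weilHermitianForm_eq_zero E hd hα (hy z)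
    rw [hE y z, h, neg_zero]
  -- Step 1: a hyperbolic family `(e, f)` with `eᵢ ∈ L` (Deligne–Milne 4.2)
  obtain ⟨e, f, heL, hee, hff, hef⟩ :=
    exists_hyperbolicFamily_of_isotropic B hB hN h2 L hL hLL'
  have hpe : ∀ i, B p (e i) = 0 := fun i => hpL' _ (heL i)
  have hqe : ∀ i, B q (e i) = 0 := fun i => hqL' _ (heL i)
  have hfe : ∀ i j, B (f i) (e j) = if i = j then 1 else 0 := fun i j => by
    rw [← hB, hef j i]
    by_cases h : i = j
    · subst h; simp
    · rw [if_neg (Ne.symm h), if_neg h, map_zero]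
  -- Step 2: orthogonalise `p`, `q` against the `fᵢ` inside `L`
  set sp : V := ∑ i, B (f i) p • e i with hsp
  set sq : V := ∑ i, B (f i) q • e i with hsq
  have hspL : sp ∈ L := Submodule.sum_mem _ fun i _ => Submodule.smul_mem _ _ (heL i)
  have hsqL : sq ∈ L := Submodule.sum_mem _ fun i _ => Submodule.smul_mem _ _ (heL i)
  set p' : V := p - sp with hp'
  set q' : V := q - sq with hq'
  -- pairings with `L`, with each other, with `e`, `f`
  have hLp : ∀ x ∈ L, B x p = 0 := fun x hx => by rw [← hB, hpL' x hx, map_zero]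
  have hLq : ∀ x ∈ L, B x q = 0 := fun x hx => by rw [← hB, hqL' x hx, map_zero]
  have hp'p' : B p' p' = algebraMap ℚ K (E p (α • p)) := by
    rw [hp']
    simp only [map_sub, LinearMap.sub_apply]
    rw [hpL' sp hspL, hLp sp hspL, hLL' sp hspL sp hspL, hBself p]
    simp
  have hq'q' : B q' q' = algebraMap ℚ K (E q (α • q)) := by
    rw [hq']
    simp only [map_sub, LinearMap.sub_apply]
    rw [hqL' sq hsqL, hLq sq hsqL, hLL' sq hsqL sq hsqL, hBself q]
    simp
  have hp'q' : B p' q' = 0 := by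
    have h1 : B sp q = 0 := hLq sp hspL
    rw [hp', hq']
    simp only [map_sub, LinearMap.sub_apply]
    rw [hpL' sq hsqL, h1, hLL' sp hspL sq hsqL, hpq']
    simp
  have hq'p' : B q' p' = 0 := by rw [← hB, hp'q', map_zero]
  have hep' : ∀ j, B (e j) p' = 0 := fun j => by
    rw [hp', map_sub, hLp _ (heL j), hLL' _ (heL j) sp hspL, sub_zero]
  have heq' : ∀ j, B (e j) q' = 0 := fun j => by
    rw [hq', map_sub, hLq _ (heL j), hLL' _ (heL j) sq hsqL, sub_zero]
  have hfsum : ∀ (c : Fin m → K) (j : Fin m), B (f j) (∑ i, c i • e i) = c j := fun c j => by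
    rw [map_sum]
    simp only [map_smul, smul_eq_mul, hfe, mul_ite, mul_one, mul_zero, Finset.sum_ite_eq, Finset.mem_univ,
      if_true]
  have hfp' : ∀ j, B (f j) p' = 0 := fun j => by
    rw [hp', map_sub, hsp, hfsum, sub_self]
  have hfq' : ∀ j, B (f j) q' = 0 := fun j => by
    rw [hq', map_sub, hsq, hfsum, sub_self]
  -- Step 3: the basis `(e, f, p̃, q̃)` and its Gram determinant `(-1)^m · Q(p) Q(q)`
  set c : (Fin m ⊕ Fin m) ⊕ Fin 2 → V := Sum.elim (Sum.elim e f) ![p', q'] with hc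
  have hG12 : (Matrix.of fun i j => B (c (Sum.inl i)) (c (Sum.inr j))) = 0 := by
    ext i j
    rcases i with i | i <;> fin_cases j <;> simp [hc, hep', heq', hfp', hfq']
  have hG11 : (Matrix.of fun i j => B (c (Sum.inl i)) (c (Sum.inl j))).det = (-1) ^ m := by
    have h := det_gramMatrix_eq_of_isotropic B hB (Sum.elim e f) (fun i j => by
      simpa only [Sum.elim_inl] using hee i j)
    have hM : (Matrix.of fun i j => B (Sum.elim e f (Sum.inl i)) (Sum.elim e f (Sum.inr j))) = 1 := by
      ext i j
      rw [Matrix.of_apply, Sum.elim_inl, Sum.elim_inr, hef, Matrix.one_apply]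
    rw [hM, Matrix.det_one, map_one, mul_one, mul_one, Fintype.card_fin] at h
    rw [← h]
    rfl
  have hG22 : (Matrix.of fun i j => B (c (Sum.inr i)) (c (Sum.inr j))).det =
      algebraMap ℚ K (E p (α • p)) * algebraMap ℚ K (E q (α • q)) := by
    rw [Matrix.det_fin_two]
    simp [hc, hp'p', hq'q', hp'q', hq'p']
  have hdetc : (gramMatrix (fun x y => B x y) c).det =
      algebraMap ℚ K ((-1) ^ m * (E p (α • p) * E q (α • q))) := by
    rw [gramMatrix_sum_eq_fromBlocks, hG12, Matrix.det_fromBlocks_zero₁₂, hG11, hG22, map_mul, map_mul,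
      map_pow, map_neg, map_one]
  set ap : ℚ := E p (α • p) with hap
  set bq : ℚ := E q (α • q) with hbq
  have hab : ap * bq < 0 := mul_neg_of_pos_of_neg hp hq
  have hu0 : (-1 : ℚ) ^ m * (ap * bq) ≠ 0 :=
    mul_ne_zero (pow_ne_zero _ (by norm_num)) hab.ne
  have hdet0 : (gramMatrix (fun x y => B x y) c).det ≠ 0 := by
    rw [hdetc]; exact (_root_.map_ne_zero _).2 hu0
  -- `c` is a `K`-basis of `V`
  have hli : LinearIndependent K c := linearIndependent_of_det_gramMatrix_ne_zero B c hdet0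
  have hcard : Fintype.card ((Fin m ⊕ Fin m) ⊕ Fin 2) = finrank K V := by
    simp only [Fintype.card_sum, Fintype.card_fin, hV]; omega
  set bc := basisOfLinearIndependentOfCardEqFinrank hli hcard with hbc
  have hbc' : (⇑bc : (Fin m ⊕ Fin m) ⊕ Fin 2 → V) = c := coe_basisOfLinearIndependentOfCardEqFinrank hli hcard
  -- the discriminant of `H` is `[(-1)^m · ap bq]`; comparing with `(-1)^{m+1}`: `-ap bq ∈ Nm(K^×)`
  set u₀ : ℚˣ := Units.mk0 _ hu0 with hu₀
  have hdisc' : (QuotientGroup.mk u₀ : ℚˣ ⧸ normUnitsSubgroup ℚ K) = QuotientGroup.mk ((-1 : ℚˣ) ^ (m + 1)) := by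
    rw [← hdisc, ← normResidueClass_algebraMap ℚ u₀, hu₀, Units.val_mk0, ← hdetc, ← hbc']
    exact (discrClass_eq_of_basis ℚ hσ B bc).symm
  have hmem : u₀⁻¹ * (-1 : ℚˣ) ^ (m + 1) ∈ normUnitsSubgroup ℚ K := QuotientGroup.eq.1 hdisc'
  have hmem' : (u₀⁻¹ * (-1 : ℚˣ) ^ (m + 1))⁻¹ ∈ normUnitsSubgroup ℚ K := inv_mem hmem
  obtain ⟨k, hk⟩ := mem_normUnitsSubgroup_iff.1 hmem'
  have hkval : (((u₀⁻¹ * (-1 : ℚˣ) ^ (m + 1))⁻¹ : ℚˣ) : ℚ) = -(ap * bq) := by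
    have h1 : ((-1 : ℚ) ^ m) * ((-1 : ℚ) ^ m) = 1 := by rw [← mul_pow]; norm_num
    have hinv : ((-1 : ℚ) ^ (m + 1))⁻¹ = (-1) ^ (m + 1) := by
      rw [← inv_pow]; congr 1; norm_num
    rw [mul_inv_rev, inv_inv, Units.val_mul, hu₀, Units.val_mk0, Units.val_inv_eq_inv_val, Units.val_pow_eq_pow_val,
      Units.val_neg, Units.val_one, hinv, pow_succ]
    linear_combination (-(ap * bq)) * h1
  rw [hkval] at hk
  -- Step 4: the isotropic vector `t = k p + ap q`, orthogonal to `L`, outside `L`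
  have hkk : (k : K) * σ k = algebraMap ℚ K (-(ap * bq)) := by rw [hσ, hk]
  have hkk' : (k : K) * σ k = -(algebraMap ℚ K ap * algebraMap ℚ K bq) := by rw [hkk, map_neg, map_mul]
  have hqp : B q p = 0 := by rw [← hB, hpq', map_zero]
  set t : V := (k : K) • p + algebraMap ℚ K ap • q with ht
  have htt : B t t = 0 := by
    rw [ht]
    simp only [map_add, LinearMap.map_smulₛₗ, map_smul, LinearMap.add_apply, LinearMap.smul_apply, smul_eq_mul,
      hσq]
    rw [hpq', hqp, hBself p, hBself q, ← hap, ← hbq]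
    linear_combination (algebraMap ℚ K ap) * hkk'
  have htL : ∀ x ∈ L, B t x = 0 := fun x hx => by
    rw [ht]
    simp only [map_add, LinearMap.map_smulₛₗ, LinearMap.add_apply, LinearMap.smul_apply, smul_eq_mul,
      hpL' x hx, hqL' x hx, mul_zero, add_zero]
  have hLt : ∀ x ∈ L, B x t = 0 := fun x hx => by rw [← hB, htL x hx, map_zero]
  have hqt : B q t = algebraMap ℚ K (ap * bq) := by
    rw [ht, map_add, map_smul, map_smul, smul_eq_mul, smul_eq_mul, hqp, mul_zero, zero_add, hBself q, ← hbq,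
      ← map_mul]
  have htnL : t ∉ L := fun h => by
    have h0 := hqL' t h
    rw [hqt] at h0
    exact hab.ne ((map_eq_zero_iff _ (algebraMap ℚ K).injective).1 h0)
  have ht0 : t ≠ 0 := fun h => htnL (h ▸ L.zero_mem)
  -- Step 5: `W = L + K t`
  refine ⟨L ⊔ K ∙ t, ?_, ?_⟩
  · have h := Submodule.finrank_sup_add_finrank_inf_eq L (K ∙ t)
    rw [((Submodule.disjoint_span_singleton' ht0).2 htnL).eq_bot, finrank_bot, add_zero, hL,
      finrank_span_singleton ht0] at h
    exact h
  · intro x hx y hy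
    obtain ⟨l, hl, z, hz, rfl⟩ := Submodule.mem_sup.1 hx
    obtain ⟨l', hl', z', hz', rfl⟩ := Submodule.mem_sup.1 hy
    obtain ⟨κ, rfl⟩ := Submodule.mem_span_singleton.1 hz
    obtain ⟨κ', rfl⟩ := Submodule.mem_span_singleton.1 hz'
    rw [← hBH]
    simp only [map_add, LinearMap.map_smulₛₗ, map_smul, LinearMap.add_apply, LinearMap.smul_apply, smul_eq_mul,
      hLL' l hl l' hl', hLt l hl, htL l' hl', htt, mul_zero, add_zero]

end LandherrStep

/-! ## §2 Coordinates `Kᴺ ≃_ℚ ℚ^{N ⊔ N}` by real and imaginary parts (`K = ℚ + ℚα`) -/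

section Coordinates

variable {K : Type*} [Field K] [Algebra ℚ K] {α : K} {d : ℚ} (hd : 0 < d) (hα : α * α = algebraMap ℚ K (-d))
  (hK : ∀ k : K, ∃ a b : ℚ, k = algebraMap ℚ K a + algebraMap ℚ K b * α)

/-- **Real/imaginary coordinates** `K^N ≃_ℚ ℚ^{N ⊔ N}`, `z ↦ (re z, im z)` (`k = re k + im k · α`), with inverse
`(v, w) ↦ v + w α`: such a `ℚ`-linear isomorphism exists. [folklore] -/
theorem exists_frameCoord (N : ℕ) :
    ∃ Θ : (Fin N → K) ≃ₗ[ℚ] (Fin N ⊕ Fin N → ℚ),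
      ∀ z, Θ z = Sum.elim (fun i => reCoord hd hα hK (z i)) (fun i => imCoord hd hα hK (z i)) :=
  ⟨{ toFun := fun z => Sum.elim (fun i => reCoord hd hα hK (z i)) (fun i => imCoord hd hα hK (z i))
     map_add' := fun z w => by
       ext k; rcases k with i | i <;> simp
     map_smul' := fun r z => by
       ext k; rcases k with i | i <;> simp
     invFun := fun v i => algebraMap ℚ K (v (Sum.inl i)) + algebraMap ℚ K (v (Sum.inr i)) * α
     left_inv := fun z => by
       funext i
       exact (eq_reCoord_add_imCoord hd hα hK (z i)).symm
     right_inv := fun v => by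
       ext k
       rcases k with i | i
       · exact reCoord_apply hd hα hK _ _
       · exact imCoord_apply hd hα hK _ _ }, fun _ => rfl⟩

variable {N : ℕ} {Θ : (Fin N → K) ≃ₗ[ℚ] (Fin N ⊕ Fin N → ℚ)}
  (hΘ : ∀ z, Θ z = Sum.elim (fun i => reCoord hd hα hK (z i)) (fun i => imCoord hd hα hK (z i)))
include hΘ

/-- `Θ z (inl i) = re (z i)`. [folklore] -/
theorem frameCoord_apply_inl (z : Fin N → K) (i : Fin N) : Θ z (Sum.inl i) = reCoord hd hα hK (z i) := by
  rw [hΘ, Sum.elim_inl]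

/-- `Θ z (inr i) = im (z i)`. [folklore] -/
theorem frameCoord_apply_inr (z : Fin N → K) (i : Fin N) : Θ z (Sum.inr i) = imCoord hd hα hK (z i) := by
  rw [hΘ, Sum.elim_inr]

/-- The standard vector `eᵢ` has coordinates `δ_{inl i}`. [folklore] -/
theorem frameCoord_single_one (i : Fin N) : Θ (Pi.single i 1) = Pi.single (Sum.inl i) 1 := by
  ext k
  rcases k with k | k
  · rw [frameCoord_apply_inl hd hα hK hΘ]
    by_cases hk : k = i
    · subst hk; rw [Pi.single_eq_same, Pi.single_eq_same, reCoord_one]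
    · rw [Pi.single_eq_of_ne hk, Pi.single_eq_of_ne (Sum.inl_injective.ne hk), map_zero]
  · rw [frameCoord_apply_inr hd hα hK hΘ, Pi.single_eq_of_ne Sum.inr_ne_inl]
    by_cases hk : k = i
    · subst hk; rw [Pi.single_eq_same, imCoord_one]
    · rw [Pi.single_eq_of_ne hk, map_zero]

/-- The vector `α eᵢ` has coordinates `δ_{inr i}`. [folklore] -/
theorem frameCoord_alpha_smul_single_one (i : Fin N) : Θ (α • Pi.single i 1) = Pi.single (Sum.inr i) 1 := by
  ext k
  rcases k with k | k
  · rw [frameCoord_apply_inl hd hα hK hΘ, Pi.single_eq_of_ne Sum.inl_ne_inr, Pi.smul_apply, smul_eq_mul]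
    by_cases hk : k = i
    · subst hk; rw [Pi.single_eq_same, mul_one, reCoord_alpha]
    · rw [Pi.single_eq_of_ne hk, mul_zero, map_zero]
  · rw [frameCoord_apply_inr hd hα hK hΘ, Pi.smul_apply, smul_eq_mul]
    by_cases hk : k = i
    · subst hk; rw [Pi.single_eq_same, Pi.single_eq_same, mul_one, imCoord_alpha]
    · rw [Pi.single_eq_of_ne hk, Pi.single_eq_of_ne (Sum.inr_injective.ne hk), mul_zero, map_zero]

/-- Multiplication by `α` in coordinates: `(re, im) ↦ (-d · im, re)`. [folklore] -/
theorem frameCoord_alpha_smul (z : Fin N → K) :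
    Θ (α • z) = Sum.elim (fun i => -d * imCoord hd hα hK (z i)) (fun i => reCoord hd hα hK (z i)) := by
  ext k
  rcases k with i | i
  · rw [frameCoord_apply_inl hd hα hK hΘ, Pi.smul_apply, smul_eq_mul, reCoord_alpha_mul, Sum.elim_inl]
  · rw [frameCoord_apply_inr hd hα hK hΘ, Pi.smul_apply, smul_eq_mul, imCoord_alpha_mul, Sum.elim_inr]

end Coordinates

end Summit.HodgeConjecture.HodgeConjecture.Ring2.Hypotheses

end
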